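import Literature.Computability.Complexity.CircuitClasses
import Literature.Computability.Complexity.TimeBounds
import HarnessLib

/-!
# One-pass streaming algorithms (space / update time) and formula-size classes `FORMULA[s]`

Trunk T-CPLX-META (Literature/Computability/MetaComplexity); definition request `wi-03789` (route
PneNP/Circuit crux #5: the vocabulary of HARDNESS MAGNIFICATION for `MCSP[s]`,
McKay–Murray–Williams STOC 2019, Oliveira–Pich–Santhanam CCC 2019, surveyed in
Chen–Hirahara–Oliveira–Pich–Rajgopal–Santhanam, arXiv:1911.08297, §1.1).

* **Streaming.** A ONE-PASS STREAMING ALGORITHM reads the input `x ∈ {0,1}^N` once, left to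
  right, maintaining a state (a bit string); it is specified by an initial state, an update map
  `(state, bit) ↦ state'` and an accepting predicate on the final state, all allowed to depend on
  the input length `N` (known in advance). It has SPACE `S` if all states along every run on
  inputs of length `N` have length `≤ S(N)`, and UPDATE TIME `T` if for each `N` some multitape
  (Mathlib `TM2`) machine computes the update map on states of length `≤ S(N)` within `T(N)` steps
  (`Turing.TM2ComputableAux.OutputsWithin`, `TimeBounds.lean`). `STREAM S T` is the class of
  languages so decided. [McKay–Murray–Williams 2019, §1–2 ("streaming algorithm using `S(N)`
  space and `T(N)` update time"); CHOPRS 2019, §1.1.] The rendering is deliberately PERMISSIVE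
  (non-uniformity in `N`, arbitrary accepting predicate, machine per `N`): magnification theorems
  are implications "`MCSP[s] ∉ STREAM S T ⇒ separation`", which only get WEAKER for a larger
  class, so vending them over this class is safe.
* **Formulas.** `FORMULA s`: languages decided by families of De Morgan FORMULAS
  (`Circuit.IsFormula`, basis `deMorganBasis = {∧₂, ∨₂, ¬}`, `Circuit.lean`) of size `≤ s(n)`,
  packaged like `SIZE s` (`CircuitClasses.lean`). Size is the tree's `Circuit.size` (number of
  gates); for De Morgan formulas the literature's LEAF-SIZE `ℓ` satisfies
  `#(∧,∨-gates) = ℓ - 1 ≤ size ≤ 3ℓ` (negations counted as gates), so `FORMULA[s]` here and the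
  leaf-size class agree up to the constant factor `3` — immaterial for the `n^{1+ε}` /
  `n^{3-ε}`-type bounds of magnification, but to be kept in mind when transcribing constants.

## References

* D. M. McKay, C. D. Murray, R. R. Williams, *Weak lower bounds on resource-bounded compression
  imply strong separations of complexity classes*, STOC 2019, §1 (streaming lower bounds for
  `MCSP` ⇒ `P ≠ NP`), §2 (model).
* I. C. Oliveira, J. Pich, R. Santhanam, *Hardness magnification near state-of-the-art lower
  bounds*, CCC 2019 (formula-size magnification).
* L. Chen, S. Hirahara, I. C. Oliveira, J. Pich, N. Rajgopal, R. Santhanam, *Beyond natural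
  proofs: hardness magnification and locality*, arXiv:1911.08297, §1.1.
* S. Jukna, *Boolean Function Complexity* (2012), §1.1–1.2 (formulas, leaf-size).
-/

noncomputable section

open Computability Literature.Computability.Complexity

namespace Literature.Computability.MetaComplexity

/-! ### One-pass streaming algorithms -/

/-- **A one-pass streaming algorithm** over `{0,1}*`: for each input length `N`, an initial
state, an update map `(state, next bit) ↦ new state`, and an accepting predicate on the final
state. [McKay–Murray–Williams 2019, §2 (streaming algorithms); CHOPRS 2019, §1.1] [cite: arXiv191108297, §1.1] -/
structure StreamingAlgorithm where
  /-- initial state on inputs of length `N` -/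
  init : ℕ → List Bool
  /-- the update map at input length `N`: `(state, bit) ↦ state'` -/
  update : ℕ → List Bool → Bool → List Bool
  /-- acceptance, as a predicate on the final state -/
  accept : ℕ → List Bool → Bool

namespace StreamingAlgorithm

variable (A : StreamingAlgorithm)

/-- The state after reading the word `x` (from the state `st`) at input length `N`.
[McKay–Murray–Williams 2019, §2] [folklore] -/
def runFrom (N : ℕ) (st : List Bool) (x : List Bool) : List Bool :=
  x.foldl (A.update N) st

/-- The final state on input `x` (input length `N = |x|`). [McKay–Murray–Williams 2019, §2] [folklore] -/
def finalState (x : List Bool) : List Bool :=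
  A.runFrom x.length (A.init x.length) x

/-- The algorithm ACCEPTS `x`. [McKay–Murray–Williams 2019, §2] [folklore] -/
def Accepts (x : List Bool) : Prop :=
  A.accept x.length (A.finalState x) = true

/-- `A` DECIDES the language `L`. [McKay–Murray–Williams 2019, §2] [folklore] -/
def Decides (L : Language Bool) : Prop :=
  ∀ x : List Bool, A.Accepts x ↔ x ∈ L

/-- **Space bound `S`**: at input length `N` the initial state and every updated state (from a
state within the bound) have length `≤ S(N)`; hence every state along a run does
(`length_runFrom_le`). [McKay–Murray–Williams 2019, §1 ("`S(N)` space")] [cite: arXiv191108297, §1.1] -/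
def HasSpace (S : ℕ → ℕ) : Prop :=
  ∀ N : ℕ, (A.init N).length ≤ S N ∧
    ∀ (st : List Bool) (b : Bool), st.length ≤ S N → (A.update N st b).length ≤ S N

/-- **Update time `T`** (relative to the space bound `S`): for each `N` some Mathlib `TM2` machine
computes `boolPair st [b] ↦ update N st b` within `T(N)` steps on all states of length `≤ S(N)`.
[McKay–Murray–Williams 2019, §1 ("`T(N)` update time"), §2] [cite: arXiv191108297, §1.1] -/
def HasUpdateTime (S T : ℕ → ℕ) : Prop :=
  ∀ N : ℕ, ∃ M : Turing.TM2ComputableAux Bool Bool,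
    ∀ (st : List Bool) (b : Bool), st.length ≤ S N →
      M.OutputsWithin (boolPair st [b]) (A.update N st b) (T N)

end StreamingAlgorithm

/-- **`STREAM S T`**: languages decided by a one-pass streaming algorithm with space `S` and update
time `T`. [McKay–Murray–Williams 2019, §1; CHOPRS 2019, §1.1] [cite: arXiv191108297, §1.1] -/
def STREAM (S T : ℕ → ℕ) : Set (Language Bool) :=
  {L | ∃ A : StreamingAlgorithm, A.HasSpace S ∧ A.HasUpdateTime S T ∧ A.Decides L}

/-! ### Formula-size classes -/

/-- **`FORMULA s`**: languages decided by families of De Morgan formulas (`{∧₂, ∨₂, ¬}`, fan-out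
`1`) of size `≤ s(n)` at every input length (size = number of gates, within a factor `3` of the
leaf-size). Packaged like `SIZE s`. [Oliveira–Pich–Santhanam 2019, §1; CHOPRS 2019, §1.1
(`Formula[s]`); Jukna 2012, §1.2] [cite: arXiv191108297, §1.1] -/
def FORMULA (s : ℕ → ℕ) : Set (Language Bool) :=
  {L | ∃ C : CircuitFamily,
    (∀ n, (C n).IsOver deMorganBasis ∧ (C n).IsFormula ∧ (C n).size ≤ s n) ∧ C.Decides L}

/-! ### API -/

/-- Along a run within the space bound, all states stay within the bound. [folklore] -/
theorem StreamingAlgorithm.length_runFrom_le (A : StreamingAlgorithm) {S : ℕ → ℕ}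
    (h : A.HasSpace S) (N : ℕ) {st : List Bool} (hst : st.length ≤ S N) (x : List Bool) :
    (A.runFrom N st x).length ≤ S N := by
  induction x generalizing st with
  | nil => simpa [StreamingAlgorithm.runFrom] using hst
  | cons b x ih =>
    simp only [StreamingAlgorithm.runFrom, List.foldl_cons]
    exact ih ((h N).2 st b hst)

/-- In particular the final state is within the space bound. [folklore] -/
theorem StreamingAlgorithm.length_finalState_le (A : StreamingAlgorithm) {S : ℕ → ℕ}
    (h : A.HasSpace S) (x : List Bool) : (A.finalState x).length ≤ S x.length :=
  A.length_runFrom_le h x.length (h x.length).1 x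

/-- `FORMULA s ⊆ SIZE s`, given the basis inclusion `deMorganBasis ⊆ B₂` (a formula is a
circuit; the tree's `SIZE` is over `B₂`). [Jukna 2012, §1.2] [folklore] -/
theorem FORMULA_subset_SIZE (hB : deMorganBasis ⊆ B2) (s : ℕ → ℕ) : FORMULA s ⊆ SIZE s := by
  rintro L ⟨C, hC, hL⟩
  exact ⟨C, fun n => ⟨(hC n).1.mono hB, (hC n).2.2⟩, hL⟩

/-- `FORMULA` is monotone in the size bound. [folklore] -/
theorem FORMULA_mono {s s' : ℕ → ℕ} (h : ∀ n, s n ≤ s' n) : FORMULA s ⊆ FORMULA s' := by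
  rintro L ⟨C, hC, hL⟩
  exact ⟨C, fun n => ⟨(hC n).1, (hC n).2.1, (hC n).2.2.trans (h n)⟩, hL⟩

/-- `STREAM` is monotone in the time bound. [folklore] -/
theorem STREAM_mono_time {S T T' : ℕ → ℕ} (h : ∀ n, T n ≤ T' n) : STREAM S T ⊆ STREAM S T' := by
  rintro L ⟨A, hS, hT, hL⟩
  refine ⟨A, hS, fun N => ?_, hL⟩
  obtain ⟨M, hM⟩ := hT N
  exact ⟨M, fun st b hst => (hM st b hst).mono (h N)⟩

/-- The one-state algorithm accepting everything decides `Set.univ` in space `0`.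
(Non-vacuity of `HasSpace`/`Decides`.) [folklore] -/
example : ∃ A : StreamingAlgorithm, A.HasSpace 0 ∧ A.Decides Set.univ :=
  ⟨⟨fun _ => [], fun _ _ _ => [], fun _ _ => true⟩,
    fun _ => ⟨le_rfl, fun _ _ _ => le_rfl⟩, fun _ => ⟨fun _ => trivial, fun _ => rfl⟩⟩

end Literature.Computability.MetaComplexity
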